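import Mathlib
import Literature.Computability.AlgebraicComplexity.OrbitClosure
import Literature.Computability.AlgebraicComplexity.LinSubst
import Literature.Computability.AlgebraicComplexity.DeterminantalComplexity
import Literature.Computability.AlgebraicComplexity.Apolarity

/-!
# Sketch — first lemmas of the three crux ideas for `FixedWitnessObstructionQP`
(crux stmt-ValiantsHypothesis-5778, route BorderApolarity). Statements only (sorried): they must
ELABORATE; they are not claimed proved here.
-/

open scoped BigOperators
open MvPolynomial

namespace Summit.ValiantsHypothesis.ValiantsHypothesis.Cruxes.FixedWitnessObstructionQP.Sketch

open Literature.Computability.AlgebraicComplexity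

/-- Idea `cone-purity-squeeze`, first lemma (CONE PURITY). For an `H₀(n,m)`-stable degree-`k`
piece `J` of a fixed witness — only two consequences of `H₀`-stability are used: stability under the
elementary substitutions `X_y ↦ X_y + c·X_z` (`y` an own variable of the padded permanent, `z` an
unused one) and under the `z`-torus — with the Hilbert-function value
`dim J = C(m²+k-1,k) - C(m,k)²` of `Ann_k(det_m)`, the budget inequality
`#{z-monomials of degree k} + C(m,k)² > C(m²+k-1,k)` forces `J` to contain NO nonzero element
free of the unused variables: `J ⊆ (∂_z)`. -/
theorem conePurity (n m k : ℕ) [NeZero m]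
    (J : Submodule ℂ (MvPolynomial (Fin m × Fin m) ℂ))
    (hhom : ∀ D ∈ J, D.IsHomogeneous k)
    (hzif : ∀ y z : Fin m × Fin m,
      ((m - n ≤ (y.1 : ℕ) ∧ m - n ≤ (y.2 : ℕ)) ∨ y = (0, 0)) →
      ¬ ((m - n ≤ (z.1 : ℕ) ∧ m - n ≤ (z.2 : ℕ)) ∨ z = (0, 0)) →
      ∀ c : ℂ, ∀ D ∈ J,
        linSubst (Fin m × Fin m) ℂ (1 + c • Matrix.single z y (1 : ℂ)) D ∈ J)
    (htor : ∀ z : Fin m × Fin m,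
      ¬ ((m - n ≤ (z.1 : ℕ) ∧ m - n ≤ (z.2 : ℕ)) ∨ z = (0, 0)) →
      ∀ d : ℂ, d ≠ 0 → ∀ D ∈ J,
        linSubst (Fin m × Fin m) ℂ (Matrix.diagonal (Function.update 1 z d)) D ∈ J)
    (hdim : Module.finrank ℂ J = Nat.choose (m * m + k - 1) k - (Nat.choose m k) ^ 2)
    (hbudget : Nat.choose (m * m + k - 1) k <
      Nat.choose (m * m - n * n - 2 + k) k + (Nat.choose m k) ^ 2) :
    ∀ D ∈ J, (∀ s ∈ D.support, ∀ v : Fin m × Fin m,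
      ¬ ((m - n ≤ (v.1 : ℕ) ∧ m - n ≤ (v.2 : ℕ)) ∨ v = (0, 0)) → s v = 0) → D = 0 := by
  sorry

/-- Idea `segre-collapse-self-similarity`, first lemma (h-VECTOR OF THE SEGRE IN THE COLLAPSED
FRAME). The Hilbert polynomial of `Seg(ℙ^{m-1} × ℙ^{m-1}) ⊂ ℙ^{m²-1}` written in the binomial basis
attached to a `(2m-2)`-plane: `C(t+m-1,m-1)² = Σ_j C(m-1,j)² · C(t+2m-2-j, 2m-2)`. Consequence
used by the line: a flat limit of translated Segres supported on a linear `ℙ^{2m-2}` with product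
(Borel-fixed) structure has transverse Artinian Hilbert function `(C(m-1,j)²)_j` = that of the
apolar algebra of `det_{m-1}`, in `(m-1)²` transverse variables. -/
theorem segre_hVector (m t : ℕ) (hm : 1 ≤ m) :
    ∑ j ∈ Finset.range m, (Nat.choose (m - 1) j) ^ 2 * Nat.choose (t + 2 * m - 2 - j) (2 * m - 2)
      = (Nat.choose (t + m - 1) (m - 1)) ^ 2 := by
  sorry

/-- Idea `toric-face-debordering`, first lemma (DE-BORDERING OF BOUNDED-WEIGHT INITIAL FORMS).
If `f = det A` with `A` an `m × m` matrix of affine linear forms and `w` is a weight with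
`w i ≤ B`, then every `w`-weighted homogeneous component of `f` (in particular the initial form
`in_w f`) has an affine determinantal expression of size polynomial in `m·B`: interpolate
`f(s^{w} x) = Σ_e s^e f_e(x)` at `m·B + 1` nodes and add the `m·B+1` size-`m` determinants with an
ABP. Uniform polynomial version (constants `C, e₀` universal). -/
theorem deborder_weightedComponent :
    ∃ C e₀ : ℕ, ∀ (σ : Type) [Fintype σ] [DecidableEq σ] (m B : ℕ) (w : σ → ℕ) (e : ℕ)
      (f : MvPolynomial σ ℂ), HasDetRepr f m → (∀ i, w i ≤ B) →
        HasDetRepr (MvPolynomial.weightedHomogeneousComponent w e f) (C * ((m + 1) * (B + 1)) ^ e₀) := by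
  sorry

/-- Idea `toric-face-debordering`, the transfer in one line (shape only): under the toric normal
form of crux `ToricFixedPoints`, an `H₀`-fixed witness makes the padded permanent a translate of a
`w`-initial form of a translate of `det_m`; with `‖w‖_∞ ≤ B` the first lemma gives
`dc(X₀₀^{m-n} per_n) ≤ C (m B)^{e₀}`, hence `dc(per_n) ≤ C (m B)^{e₀}` (set `X₀₀ = 1`). -/
theorem dc_paddedPer_of_boundedWeight_initialForm :
    ∃ C e₀ : ℕ, ∀ (n m B : ℕ) [NeZero m], n ≤ m →
      ∀ (u g : Matrix.GeneralLinearGroup (Fin m × Fin m) ℂ) (w : Fin m × Fin m → ℕ) (e : ℕ),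
        (∀ i, w i ≤ B) →
        paddedPerPoly ℂ n m =
          linSubst (Fin m × Fin m) ℂ (u : Matrix (Fin m × Fin m) (Fin m × Fin m) ℂ)
            (MvPolynomial.weightedHomogeneousComponent w e
              (linSubst (Fin m × Fin m) ℂ (g : Matrix (Fin m × Fin m) (Fin m × Fin m) ℂ)
                (detPoly (Fin m) ℂ))) →
        HasDetRepr (perPoly (Fin n) ℂ) (C * ((m + 1) * (B + 1)) ^ e₀) := by
  sorry

end Summit.ValiantsHypothesis.ValiantsHypothesis.Cruxes.FixedWitnessObstructionQP.Sketch
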